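import Summits.BirchSwinnertonDyer.Rank1Residual.Additive.X4SharpThreeKimRankOneShape
import Summits.BirchSwinnertonDyer.Rank1Residual.X4.OptimalPeriod
import Summits.BirchSwinnertonDyer.Rank1Residual.Additive.X4SharpThreeAssembly
import Literature.NumberTheory.EllipticCurves.Rank1Residual.Typed.CasselsLowerBound
import HarnessLib

/-!
# X4 ∧ `r_an = 1` at `p = 3`: CONSEQUENCES of the typed rank-one Kim-at-3 shapes — per-pair
# `BSD(E,p) ⟺ ord_p #Ш_an = 0` from one Kurihara number, level two + Cassels–Tate, consistency on
# closed rows, the falsifiable prediction, and the `p = 3` census shapes on O7 ∩ X4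
# (cell `b2b-bsdres`, team n1011, sub-target T-a2r1; sibling of `Additive/X4SharpThreeKimRankOneShape.lean`)

HONEST FRAMING (cell `b2b-bsdres`, run/shared/lean/b2b/bsd-rank1-residual/, verbatim in every
file): the goal of the cell is to DELETE the COMBINATION-SHAPED residual classes of the
Birch–Swinnerton-Dyer formula for ALL analytic-rank `≤ 1` elliptic curves over `ℚ` — "full BSD
formula for every rank `≤ 1` curve in class `C`" assembled STRICTLY from published theorems — so
that the rank-`≤ 1` remainder becomes exactly the CONSTRUCTION-SHAPED classes, which are TYPED
(missing-input `Prop`s), NOT attempted. This is not "finishing BSD". Team n1011: prove what is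
provable now; shrink each hard class to its core with data; no claim beyond stated classes;
research routes; census output = EVIDENCE / conjecture items, never a Literature fact. X4 stays
CONSTRUCTION-SHAPED; nothing here is booked; §I O7 / N11 unchanged. Theorems only (no definition,
no named fact); every published input and every conjecture is an explicit hypothesis.

## What this file proves (all per pair; NOT class theorems)

With the per-pair predicates `KimRankOneUnitAt W p` / `KimRankOneLevelTwoAt W p` of the sibling file
(Kim 2026 Thm. 1.9 (1)(4)(6) rank-one shapes, `5 ≤ p` removed, tower added — THEOREMS at `p ≥ 5`,
the conjectures `X4SharpThreeKimRankOne*` at an additive `3`) as explicit hypotheses: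

* §1 `bsdp_iff_padicValRat_eq_zero_of_kimRankOneUnitAt`: tower, `L(E,1) = 0`, `r_an = 1`, datum `D`
  with `p ∤ c_D`, period transfer, ONE unit Kurihara number at a cyclic `ℓ ∈ 𝒫₁`, `#Ш_an = q` ⟹
  `BSD(E,p) ⟺ ord_p q = 0` (GZK `hGZK` for rank and finiteness; the bookkeeping is the tree's
  `X4.bsdp_iff_padicValRat_eq_zero_of_card_primaryComponent_eq_one`); `bsdp_of_kimRankOneUnitAt_of_shaAn_unit`.
* §2 `padicValNat_shaOrder_eq_zero_of_kimRankOneLevelTwoAt_of_casselsTate` and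
  `bsdp_of_kimRankOneLevelTwoAt_of_casselsTate`: level two + Cassels–Tate parity (an even number
  `≤ 1` is `0`) — the `ord_p ∏ c_ℓ = 1` rows; verbatim twin of `Additive/RankOneTamagawaParity.lean`.
* §3 CONSISTENCY (fact-free + GZK): `kimRankOneUnitAt_of_bsdp_of_shaAn_unit` — on a rank-one pair
  where `BSD(E,p)` holds with `ord_p #Ш_an = 0` the unit predicate is TRUE (whatever the
  certificate); so no kernel-closed unit row can contradict the conjecture. PREDICTION:
  `kuriharaNumber_eq_zero_of_kimRankOneUnitAt_of_bsdp_of_ne_zero` — on a pair where `BSD(E,p)` holds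
  with `ord_p #Ш_an ≠ 0`, the predicate FORBIDS a unit Kurihara number at every cyclic `ℓ ∈ 𝒫₁`
  (falsifiable by the census: ONE unit there refutes the conjecture at that pair or a named fact
  of the closure).
* §4 the `p = 3` census shapes on O7 ∩ X4: `X4RankOne.bsdp_three_of_kimShape_of_cert_…` —
  `ClassX4 W 3`, surj(3) + tower certificate (`j`-witness ∨ surj(9),
  `towerSurj_three_of_surj_of_jWitness_or_nine`), `r_an = 1`, `#Ш_an` a `3`-unit, datum (optimal
  variant: period binder discharged by `X4.periodTransfer_of_optimal`), ONE unit Kurihara number at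
  `3` ⟹ `BSD(E,3)` MODULO `X4SharpThreeKimRankOne`; the level-two + Cassels–Tate shape MODULO
  `X4SharpThreeKimRankOneLevelTwo`; and in Miller's currency `X4.MissingInputAt W 3 ⟺ ord₃ #Ш_an = 0`.

Where it bites (counts of record, RESIDUAL-MAP §I O7 / CLASS-CLOSURE §3.3; this seat re-derives
nothing): X4 ∧ `r = 1` at `3`: 10 677 cells, S-b 10 105 surj(3) pairs, Heegner route "`p ∣ I_K` on
every census pair"; per pair so far only additive-p1's Heegner-index / BALANCE certificates on (M).
The instrument is I-12 extended to `p = 3` (ENG-A); controls = the X4(M)@3 rank-one pairs already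
closed by two-engine Heegner-index certificates (additive-p1 records p239723).

References: Kim 2026 [Kim2022StructureSelmer] Thm. 1.9 (1)(4)(6), §1.2.5, Conj. 1.10; Kim 2025
preprint arXiv:2505.09121 Thm. 1.1; Sakamoto 2024 [Sakamoto2024KolyvaginThree]; Cassels 1962 /
Silverman *AEC* X.4.14 [SilvermanAEC2009]; Miller 2011 [Miller2011LMS] Def. 1.1; Cremona
*Algorithms* §2.8 [CremonaAlgorithms1997]; Serre 1972 [Serre1972] IV §3.4.
-/

noncomputable section

open scoped Classical MatrixGroups ModularForm

open CongruenceSubgroup WeierstrassCurve Literature.NumberTheory.EllipticCurves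
  Literature.NumberTheory.EllipticCurves.ModularForms
  Literature.NumberTheory.EllipticCurves.Rank1Residual
  Literature.NumberTheory.EllipticCurves.Rank1Residual.Typed

namespace Summit.BirchSwinnertonDyer.Rank1Residual.Additive

variable (W : WeierstrassCurve ℚ) [W.IsElliptic] [W.IsGloballyMinimal] (p : ℕ) [Fact p.Prime]

/-! ## §1 `BSD(E,p) ⟺ ord_p #Ш_an = 0` from the unit predicate (ANY reduction at `p`) -/

/-- **Rank-one residue from the unit predicate, ANY reduction at `p`**: granted `KimRankOneUnitAt W p`
(a theorem at `p ≥ 5`; the conjecture `X4SharpThreeKimRankOne` at an additive `3`) and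
Gross–Zagier–Kolyvagin (`hGZK`), a pair with surj(p), the tower, `L(E,1) = 0`, `r_an = 1`, datum `D`
with `p ∤ c_D`, period transfer, ONE unit Kurihara number at a cyclic `ℓ ∈ 𝒫₁(E,p)` and `#Ш_an = q`
satisfies `BSD(E,p) ⟺ ord_p q = 0`. Per pair; NOT a class theorem.
[cite: Kim2022StructureSelmer, Thm. 1.9 (1), (4), (6) (PDF pp. 7–8)] [cite: Miller2011LMS, Def. 1.1] -/
theorem bsdp_iff_padicValRat_eq_zero_of_kimRankOneUnitAt (hK : KimRankOneUnitAt W p)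
    (hGZK : rank_eq_analyticRank_of_analyticRank_le_one)
    (hsurj : W.HasSurjectiveModNGaloisRep p)
    (htower : ∀ n : ℕ, W.HasSurjectiveModNGaloisRep (p ^ n : ℕ)) (hL : W.entireLFunction 1 = 0)
    (hr : W.analyticRank = 1)
    {N : ℕ} [NeZero N] (D : ModularParametrizationData W N) (hc : ¬ (p : ℤ) ∣ D.maninConstant)
    (hper : ∃ u : ℚ, ‖(u : ℚ_[p])‖ = 1 ∧ W.realPeriodRat = u * plusPeriod D.f)
    (ℓ : ℕ) [Fact ℓ.Prime] (hℓ : Kato.IsKolyvaginPrime W p 1 ℓ)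
    (hcyc : Nat.card {P : ((WeierstrassCurve.integralModelInt W).map
        (Int.castRingHom (ZMod ℓ))).toAffine.Point // p • P = 0} ≤ p)
    (ψ : (ℓ' : ℕ) → (ZMod ℓ')ˣ →* Multiplicative (ZMod (p ^ 1)))
    (hψ : Function.Surjective (ψ ℓ)) (hδ : kuriharaNumber D.f (p ^ 1) ℓ ψ ≠ 0)
    {q : ℚ} (hq : shaAn W = (q : ℂ)) : BSDp W p ↔ padicValRat p q = 0 := by
  obtain ⟨hmw, hfin⟩ := hGZK W (by rw [hr])
  have hcard := hK hsurj htower hL hr hfin D hc hper ℓ hℓ hcyc ψ hψ hδ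
  exact X4.bsdp_iff_padicValRat_eq_zero_of_card_primaryComponent_eq_one W p hmw hfin hcard hq

/-- **`BSD(E,p)` from the unit predicate, one unit Kurihara number and a `p`-unit `#Ш_an`**, ANY
reduction at `p`; modularity `hmod` reads `r_an = 1` as `L(E,1) = 0`. Per pair; NOT a class
theorem. [cite: Kim2022StructureSelmer, Thm. 1.9 (1), (4), (6) (PDF pp. 7–8)] [cite: Miller2011LMS, Def. 1.1] -/
theorem bsdp_of_kimRankOneUnitAt_of_shaAn_unit (hK : KimRankOneUnitAt W p)
    (hGZK : rank_eq_analyticRank_of_analyticRank_le_one) (hmod : hasEntireLFunction_rat)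
    (hsurj : W.HasSurjectiveModNGaloisRep p)
    (htower : ∀ n : ℕ, W.HasSurjectiveModNGaloisRep (p ^ n : ℕ)) (hr : W.analyticRank = 1)
    {N : ℕ} [NeZero N] (D : ModularParametrizationData W N) (hc : ¬ (p : ℤ) ∣ D.maninConstant)
    (hper : ∃ u : ℚ, ‖(u : ℚ_[p])‖ = 1 ∧ W.realPeriodRat = u * plusPeriod D.f)
    (ℓ : ℕ) [Fact ℓ.Prime] (hℓ : Kato.IsKolyvaginPrime W p 1 ℓ)
    (hcyc : Nat.card {P : ((WeierstrassCurve.integralModelInt W).map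
        (Int.castRingHom (ZMod ℓ))).toAffine.Point // p • P = 0} ≤ p)
    (ψ : (ℓ' : ℕ) → (ZMod ℓ')ˣ →* Multiplicative (ZMod (p ^ 1)))
    (hψ : Function.Surjective (ψ ℓ)) (hδ : kuriharaNumber D.f (p ^ 1) ℓ ψ ≠ 0)
    {q : ℚ} (hq : shaAn W = (q : ℂ)) (hv : padicValRat p q = 0) : BSDp W p := by
  have hL : W.entireLFunction 1 = 0 := by
    by_contra hne
    have h0 := (W.analyticRank_eq_zero_iff_holds (hmod W)).mpr hne
    omega
  exact (bsdp_iff_padicValRat_eq_zero_of_kimRankOneUnitAt W p hK hGZK hsurj htower hL hr D hc hper ℓ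
    hℓ hcyc ψ hψ hδ hq).mpr hv

/-! ## §2 Level two + Cassels–Tate (the `ord_p ∏ c_ℓ = 1` rows) -/

/-- **Level two + Cassels–Tate: `ord_p #Ш(E/ℚ) = 0`** from `KimRankOneLevelTwoAt W p` (`ord_p #Ш(p) ≤ 1`)
and the squareness of `#Ш` (`hCT`, bsd.S18; `Ш` finite by `hGZK`): an even number `≤ 1` is `0`.
ANY reduction at `p`. Per pair. [cite: Kim2022StructureSelmer, Thm. 1.9 (6) (PDF p. 8), §1.2.2, §1.5.1]
[cite: SilvermanAEC2009, Thm. X.4.14] -/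
theorem padicValNat_shaOrder_eq_zero_of_kimRankOneLevelTwoAt_of_casselsTate
    (hK2 : KimRankOneLevelTwoAt W p) (hCT : exists_casselsTate_pairing (K := ℚ))
    (hGZK : rank_eq_analyticRank_of_analyticRank_le_one) (hmod : hasEntireLFunction_rat)
    (hsurj : W.HasSurjectiveModNGaloisRep p)
    (htower : ∀ n : ℕ, W.HasSurjectiveModNGaloisRep (p ^ n : ℕ)) (hr : W.analyticRank = 1)
    {N : ℕ} [NeZero N] (D : ModularParametrizationData W N) (hc : ¬ (p : ℤ) ∣ D.maninConstant)
    (hper : ∃ u : ℚ, ‖(u : ℚ_[p])‖ = 1 ∧ W.realPeriodRat = u * plusPeriod D.f)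
    (ℓ : ℕ) [Fact ℓ.Prime] (hℓ : Kato.IsKolyvaginPrime W p 2 ℓ)
    (hcyc : Nat.card {P : ((WeierstrassCurve.integralModelInt W).map
        (Int.castRingHom (ZMod ℓ))).toAffine.Point // p • P = 0} ≤ p)
    (ψ : (ℓ' : ℕ) → (ZMod ℓ')ˣ →* Multiplicative (ZMod (p ^ 2)))
    (hψ : Function.Surjective (ψ ℓ)) (hδ : kuriharaNumber D.f (p ^ 2) ℓ ψ ≠ 0) :
    padicValNat p W.shaOrder = 0 := by
  have hr1 : W.analyticRank ≤ 1 := by rw [hr]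
  have hL : W.entireLFunction 1 = 0 := by
    by_contra hne
    have h0 := (W.analyticRank_eq_zero_iff_holds (hmod W)).mpr hne
    omega
  have hfin : W.ShaFinite := (hGZK W hr1).2
  haveI : Finite W.sha := hfin
  have hle : padicValNat p (Nat.card (AddCommGroup.primaryComponent W.sha p)) ≤ 1 :=
    hK2 hsurj htower hL hr hfin D hc hper ℓ hℓ hcyc ψ hψ hδ
  rw [padicValNat_card_addPrimaryComponent p] at hle
  have hsq : IsSquare W.shaOrder := isSquare_shaOrder_of_casselsTate hCT W hfin
  have hn : W.shaOrder ≠ 0 := (WeierstrassCurve.shaOrder_pos W hfin).ne'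
  by_contra h
  have hdvd : p ∣ W.shaOrder := by
    by_contra hnd
    exact h (padicValNat.eq_zero_of_not_dvd hnd)
  have h2 : 2 ≤ padicValNat p W.shaOrder := two_le_padicValNat_of_isSquare_of_dvd hsq hn hdvd
  have : padicValNat p W.shaOrder ≤ 1 := by
    unfold WeierstrassCurve.shaOrder; exact hle
  omega

/-- **`BSD(E,p)` in analytic rank `1` from the level-two predicate, ONE Kurihara number non-zero
modulo `p²`, Cassels–Tate and a `p`-unit `#Ш_an`** — ANY reduction at `p`. Per pair; NOT a class
theorem. [cite: Kim2022StructureSelmer, Thm. 1.9 (6) (PDF p. 8), Conj. 1.10] [cite: SilvermanAEC2009, Thm. X.4.14]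
[cite: Miller2011LMS, Def. 1.1] -/
theorem bsdp_of_kimRankOneLevelTwoAt_of_casselsTate
    (hK2 : KimRankOneLevelTwoAt W p) (hCT : exists_casselsTate_pairing (K := ℚ))
    (hGZK : rank_eq_analyticRank_of_analyticRank_le_one) (hmod : hasEntireLFunction_rat)
    (hsurj : W.HasSurjectiveModNGaloisRep p)
    (htower : ∀ n : ℕ, W.HasSurjectiveModNGaloisRep (p ^ n : ℕ)) (hr : W.analyticRank = 1)
    {q : ℚ} (hq : shaAn W = (q : ℂ)) (hv : padicValRat p q = 0)
    {N : ℕ} [NeZero N] (D : ModularParametrizationData W N) (hc : ¬ (p : ℤ) ∣ D.maninConstant)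
    (hper : ∃ u : ℚ, ‖(u : ℚ_[p])‖ = 1 ∧ W.realPeriodRat = u * plusPeriod D.f)
    (ℓ : ℕ) [Fact ℓ.Prime] (hℓ : Kato.IsKolyvaginPrime W p 2 ℓ)
    (hcyc : Nat.card {P : ((WeierstrassCurve.integralModelInt W).map
        (Int.castRingHom (ZMod ℓ))).toAffine.Point // p • P = 0} ≤ p)
    (ψ : (ℓ' : ℕ) → (ZMod ℓ')ˣ →* Multiplicative (ZMod (p ^ 2)))
    (hψ : Function.Surjective (ψ ℓ)) (hδ : kuriharaNumber D.f (p ^ 2) ℓ ψ ≠ 0) : BSDp W p := by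
  have hr1 : W.analyticRank ≤ 1 := by rw [hr]
  have hfin : W.ShaFinite := (hGZK W hr1).2
  have h0 : padicValNat p W.shaOrder = 0 :=
    padicValNat_shaOrder_eq_zero_of_kimRankOneLevelTwoAt_of_casselsTate W p hK2 hCT hGZK hmod hsurj
      htower hr D hc hper ℓ hℓ hcyc ψ hψ hδ
  have hn : W.shaOrder ≠ 0 := (WeierstrassCurve.shaOrder_pos W hfin).ne'
  have hnd : ¬ p ∣ W.shaOrder := by
    intro hdvd
    have := (padicValNat_dvd_iff_le hn).1 (by simpa using hdvd : p ^ 1 ∣ W.shaOrder)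
    omega
  refine bsdp_of_shaAn_unit_of_noPTorsion W p hGZK hr1 hq hv ?_
  intro x hx
  by_contra hx0
  refine hnd (dvd_shaOrder_of_exists_torsion W p ⟨x, hx0, ?_⟩)
  rw [← natCast_zsmul]
  exact hx

/-! ## §3 Consistency on closed rows, and the falsifiable prediction -/

omit [Fact p.Prime] in
/-- **Consistency** (fact-free apart from `hGZK`): on a rank-one pair where `BSD(E,p)` holds with
`#Ш_an` a `p`-unit, `#Ш(E/ℚ)(p) = 1`; hence the unit predicate `KimRankOneUnitAt W p` holds there
trivially (its conclusion is true whatever the certificate). So NO kernel-closed rank-one unit row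
can contradict the conjecture `X4SharpThreeKimRankOne`. [cite: Miller2011LMS, Def. 1.1] -/
theorem kimRankOneUnitAt_of_bsdp_of_shaAn_unit [Fact p.Prime] (hB : BSDp W p)
    {q : ℚ} (hq : shaAn W = (q : ℂ)) (hv : padicValRat p q = 0) : KimRankOneUnitAt W p := by
  intro _ _ _ _ hfin _ _ _ _ _ _ _ _ _ _ _ _
  haveI : Finite W.sha := hfin
  obtain ⟨-, -, q', hq', hv'⟩ := hB
  have hqq : q' = q := by exact_mod_cast hq'.symm.trans hq
  rw [hqq, hv] at hv'
  have h0 : padicValNat p (Nat.card (AddCommGroup.primaryComponent W.sha p)) = 0 := by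
    exact_mod_cast hv'.symm
  -- a finite `p`-primary group of `p`-adic valuation `0` is trivial
  obtain ⟨k, hk⟩ := exists_card_addPrimaryComponent_eq_pow (A := W.sha) p
  rw [hk] at h0 ⊢
  rw [padicValNat.prime_pow] at h0
  rw [h0, pow_zero]

/-- **The falsifiable prediction**: on a rank-one pair satisfying surj(p), the tower, `p ∤ c_D`, the
period transfer, where `BSD(E,p)` holds with `ord_p #Ш_an ≠ 0` (e.g. `#Ш_an = p²`), the unit
predicate `KimRankOneUnitAt W p` FORBIDS a unit Kurihara number at every cyclic `ℓ ∈ 𝒫₁(E,p)`: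
`kuriharaNumber D.f p ℓ ψ = 0`. At `p ≥ 5` this is a theorem (Kim); at `p = 3` ONE unit found by
the census on such a row refutes `X4SharpThreeKimRankOne` at that pair (or a named fact of the
row's closure) — anomaly protocol. [cite: Kim2022StructureSelmer, Thm. 1.9 (6), Conj. 1.10 (PDF p. 8)]
[cite: Miller2011LMS, Def. 1.1] -/
theorem kuriharaNumber_eq_zero_of_kimRankOneUnitAt_of_bsdp_of_ne_zero (hK : KimRankOneUnitAt W p)
    (hGZK : rank_eq_analyticRank_of_analyticRank_le_one)
    (hsurj : W.HasSurjectiveModNGaloisRep p)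
    (htower : ∀ n : ℕ, W.HasSurjectiveModNGaloisRep (p ^ n : ℕ)) (hL : W.entireLFunction 1 = 0)
    (hr : W.analyticRank = 1) (hB : BSDp W p)
    {q : ℚ} (hq : shaAn W = (q : ℂ)) (hv : padicValRat p q ≠ 0)
    {N : ℕ} [NeZero N] (D : ModularParametrizationData W N) (hc : ¬ (p : ℤ) ∣ D.maninConstant)
    (hper : ∃ u : ℚ, ‖(u : ℚ_[p])‖ = 1 ∧ W.realPeriodRat = u * plusPeriod D.f)
    (ℓ : ℕ) [Fact ℓ.Prime] (hℓ : Kato.IsKolyvaginPrime W p 1 ℓ)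
    (hcyc : Nat.card {P : ((WeierstrassCurve.integralModelInt W).map
        (Int.castRingHom (ZMod ℓ))).toAffine.Point // p • P = 0} ≤ p)
    (ψ : (ℓ' : ℕ) → (ZMod ℓ')ˣ →* Multiplicative (ZMod (p ^ 1)))
    (hψ : Function.Surjective (ψ ℓ)) : kuriharaNumber D.f (p ^ 1) ℓ ψ = 0 := by
  by_contra hδ
  exact hv ((bsdp_iff_padicValRat_eq_zero_of_kimRankOneUnitAt W p hK hGZK hsurj htower hL hr D hc
    hper ℓ hℓ hcyc ψ hψ hδ hq).mp hB)

/-! ## §4 The `p = 3` census shapes on O7 ∩ X4 (modulo the conjectures) -/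

/-- **O7 ∩ X4@3, unit certificate**: on `ClassX4 W 3` ∧ `r_an = 1` with surj(3) and a tower
certificate (`j`-witness: a prime `q ≠ 3` with `ord_q j < 0`, `3 ∤ ord_q j`; or surj(9)), a datum `D`
with `3 ∤ c_D` and the period transfer, ONE unit Kurihara number `δ̃_ℓ ≢ 0 (mod 3)` at a cyclic
`ℓ ∈ 𝒫₁(E,3)`, and `#Ш_an = q` a `3`-unit: `BSD(E,3)` — MODULO the conjecture
`X4SharpThreeKimRankOne` (explicit hypothesis `h3`; OPEN; announced in the preprint Kim 2025
Thm. 1.1 up to the period bridge). Per pair; NOT a class theorem; X4 / O7 labels unchanged.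
[cite: Kim2022StructureSelmer, Thm. 1.9 (1), (4), (6) (PDF pp. 7–8), §1.2.5 (PDF p. 5)]
[cite: SerreAbelianLadic1968, Ch. IV §3.4, Lemma 3 (IV-23)] [cite: Miller2011LMS, Def. 1.1] -/
theorem X4RankOne.bsdp_three_of_kimShape_of_cert_of_kuriharaNumber (h3 : X4SharpThreeKimRankOne)
    (hGZK : rank_eq_analyticRank_of_analyticRank_le_one) (hmod : hasEntireLFunction_rat)
    (hX : ClassX4 W 3) (hsurj : Surj W 3)
    (hcert : (∃ q : ℕ, q.Prime ∧ q ≠ 3 ∧ padicValRat q W.j < 0 ∧ ¬ (3 : ℤ) ∣ padicValRat q W.j) ∨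
      W.HasSurjectiveModNGaloisRep 9)
    (hr : W.analyticRank = 1) {q : ℚ} (hq : shaAn W = (q : ℂ)) (hv : padicValRat 3 q = 0)
    {N : ℕ} [NeZero N] (D : ModularParametrizationData W N) (hc : ¬ (3 : ℤ) ∣ D.maninConstant)
    (hper : ∃ u : ℚ, ‖(u : ℚ_[3])‖ = 1 ∧ W.realPeriodRat = u * plusPeriod D.f)
    (ℓ : ℕ) [Fact ℓ.Prime] (hℓ : Kato.IsKolyvaginPrime W 3 1 ℓ)
    (hcyc : Nat.card {P : ((WeierstrassCurve.integralModelInt W).map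
        (Int.castRingHom (ZMod ℓ))).toAffine.Point // 3 • P = 0} ≤ 3)
    (ψ : (ℓ' : ℕ) → (ZMod ℓ')ˣ →* Multiplicative (ZMod (3 ^ 1)))
    (hψ : Function.Surjective (ψ ℓ)) (hδ : kuriharaNumber D.f (3 ^ 1) ℓ ψ ≠ 0) : BSDp W 3 :=
  bsdp_of_kimRankOneUnitAt_of_shaAn_unit W 3 (kimRankOneUnitAt_three_of_classX4 W h3 hX) hGZK hmod
    hsurj (towerSurj_three_of_surj_of_jWitness_or_nine W hsurj hcert) hr D (by exact_mod_cast hc)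
    hper ℓ hℓ hcyc ψ hψ hδ hq hv

/-- **O7 ∩ X4@3, unit certificate, OPTIMAL datum** (period binder discharged by
`X4.periodTransfer_of_optimal`: `Ω(W) = |c|·Ω⁺_f`, so `u = |c|` is a `3`-adic unit iff `3 ∤ c`): the
remaining non-certificate input per pair is "`D` optimal with `3 ∤ c`" (Cremona `…1` curves,
`N ≤ 130000`: Agashe–Ribet–Stein 2006 Thm. 2.6) — and the conjecture. Per pair.
[cite: Kim2022StructureSelmer, Thm. 1.9 (1), (4), (6) and §1.3.5] [cite: CremonaAlgorithms1997, §2.8 (p. 26)]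
[cite: AgasheRibetStein2006, Thm. 2.6] [cite: Miller2011LMS, Def. 1.1] -/
theorem X4RankOne.bsdp_three_of_kimShape_of_cert_of_optimal_of_kuriharaNumber
    (h3 : X4SharpThreeKimRankOne)
    (hGZK : rank_eq_analyticRank_of_analyticRank_le_one) (hmod : hasEntireLFunction_rat)
    (hX : ClassX4 W 3) (hsurj : Surj W 3)
    (hcert : (∃ q : ℕ, q.Prime ∧ q ≠ 3 ∧ padicValRat q W.j < 0 ∧ ¬ (3 : ℤ) ∣ padicValRat q W.j) ∨
      W.HasSurjectiveModNGaloisRep 9)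
    (hr : W.analyticRank = 1) {q : ℚ} (hq : shaAn W = (q : ℂ)) (hv : padicValRat 3 q = 0)
    {N : ℕ} [NeZero N] (D : ModularParametrizationData W N)
    (hopt : ∀ z ∈ D.L.lattice, ∃ w ∈ periodLattice D.f, z = D.c * w)
    (hc : ¬ (3 : ℤ) ∣ D.maninConstant)
    (ℓ : ℕ) [Fact ℓ.Prime] (hℓ : Kato.IsKolyvaginPrime W 3 1 ℓ)
    (hcyc : Nat.card {P : ((WeierstrassCurve.integralModelInt W).map
        (Int.castRingHom (ZMod ℓ))).toAffine.Point // 3 • P = 0} ≤ 3)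
    (ψ : (ℓ' : ℕ) → (ZMod ℓ')ˣ →* Multiplicative (ZMod (3 ^ 1)))
    (hψ : Function.Surjective (ψ ℓ)) (hδ : kuriharaNumber D.f (3 ^ 1) ℓ ψ ≠ 0) : BSDp W 3 :=
  X4RankOne.bsdp_three_of_kimShape_of_cert_of_kuriharaNumber W h3 hGZK hmod hX hsurj hcert hr hq hv D
    hc (X4.periodTransfer_of_optimal 3 D hopt (by exact_mod_cast hc)) ℓ hℓ hcyc ψ hψ hδ

/-- **O7 ∩ X4@3, level-two certificate + Cassels–Tate** (the `ord₃ ∏ c_ℓ = 1` rows, e.g. Kodaira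
IV / IV* with `c₃ = 3`): on `ClassX4 W 3` ∧ `r_an = 1` with surj(3) and a tower certificate, a datum
`D` with `3 ∤ c_D` and the period transfer, ONE Kurihara number `δ̃_ℓ ≢ 0 (mod 9)` at a cyclic
`ℓ ∈ 𝒫₂(E,3)`, Cassels–Tate `hCT`, and `#Ш_an` a `3`-unit: `BSD(E,3)` — MODULO the conjecture
`X4SharpThreeKimRankOneLevelTwo` (explicit hypothesis `h3`; OPEN). Per pair; NOT a class theorem.
[cite: Kim2022StructureSelmer, Thm. 1.9 (6) (PDF p. 8), Conj. 1.10] [cite: SilvermanAEC2009, Thm. X.4.14]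
[cite: Miller2011LMS, Def. 1.1] -/
theorem X4RankOne.bsdp_three_of_kimLevelTwoShape_of_cert_of_casselsTate_of_kuriharaNumber
    (h3 : X4SharpThreeKimRankOneLevelTwo) (hCT : exists_casselsTate_pairing (K := ℚ))
    (hGZK : rank_eq_analyticRank_of_analyticRank_le_one) (hmod : hasEntireLFunction_rat)
    (hX : ClassX4 W 3) (hsurj : Surj W 3)
    (hcert : (∃ q : ℕ, q.Prime ∧ q ≠ 3 ∧ padicValRat q W.j < 0 ∧ ¬ (3 : ℤ) ∣ padicValRat q W.j) ∨
      W.HasSurjectiveModNGaloisRep 9)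
    (hr : W.analyticRank = 1) {q : ℚ} (hq : shaAn W = (q : ℂ)) (hv : padicValRat 3 q = 0)
    {N : ℕ} [NeZero N] (D : ModularParametrizationData W N) (hc : ¬ (3 : ℤ) ∣ D.maninConstant)
    (hper : ∃ u : ℚ, ‖(u : ℚ_[3])‖ = 1 ∧ W.realPeriodRat = u * plusPeriod D.f)
    (ℓ : ℕ) [Fact ℓ.Prime] (hℓ : Kato.IsKolyvaginPrime W 3 2 ℓ)
    (hcyc : Nat.card {P : ((WeierstrassCurve.integralModelInt W).map
        (Int.castRingHom (ZMod ℓ))).toAffine.Point // 3 • P = 0} ≤ 3)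
    (ψ : (ℓ' : ℕ) → (ZMod ℓ')ˣ →* Multiplicative (ZMod (3 ^ 2)))
    (hψ : Function.Surjective (ψ ℓ)) (hδ : kuriharaNumber D.f (3 ^ 2) ℓ ψ ≠ 0) : BSDp W 3 :=
  bsdp_of_kimRankOneLevelTwoAt_of_casselsTate W 3 (kimRankOneLevelTwoAt_three_of_classX4 W h3 hX) hCT
    hGZK hmod hsurj (towerSurj_three_of_surj_of_jWitness_or_nine W hsurj hcert) hr hq hv D
    (by exact_mod_cast hc) hper ℓ hℓ hcyc ψ hψ hδ

/-- **What the conjecture buys on O7 ∩ X4@3 in Miller's currency**: under `X4SharpThreeKimRankOne`, on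
an X4 ∧ `r_an = 1` pair at `3` with surj(3), the tower, a datum with `3 ∤ c_D`, the period transfer
and ONE unit Kurihara number at `3`, the typed missing input `X4.MissingInputAt W 3`
(= `MissingPPartAt W 3`) holds iff `ord₃ #Ш_an = 0` — the remaining input is the VALUE `ord₃ #Ш_an`
(a two-engine number per pair), not a class statement. Per pair. [cite: Miller2011LMS, Def. 1.1]
[cite: Kim2022StructureSelmer, Thm. 1.9 (1), (4), (6) (PDF pp. 7–8)] -/
theorem X4RankOne.missingInputAt_three_iff_of_kimShape_of_kuriharaNumber
    (h3 : X4SharpThreeKimRankOne)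
    (hGZK : rank_eq_analyticRank_of_analyticRank_le_one) (hmod : hasEntireLFunction_rat)
    (hX : ClassX4 W 3) (hsurj : Surj W 3) (htower : ∀ n : ℕ, W.HasSurjectiveModNGaloisRep (3 ^ n : ℕ))
    (hr : W.analyticRank = 1) {q : ℚ} (hq : shaAn W = (q : ℂ))
    {N : ℕ} [NeZero N] (D : ModularParametrizationData W N) (hc : ¬ (3 : ℤ) ∣ D.maninConstant)
    (hper : ∃ u : ℚ, ‖(u : ℚ_[3])‖ = 1 ∧ W.realPeriodRat = u * plusPeriod D.f)
    (ℓ : ℕ) [Fact ℓ.Prime] (hℓ : Kato.IsKolyvaginPrime W 3 1 ℓ)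
    (hcyc : Nat.card {P : ((WeierstrassCurve.integralModelInt W).map
        (Int.castRingHom (ZMod ℓ))).toAffine.Point // 3 • P = 0} ≤ 3)
    (ψ : (ℓ' : ℕ) → (ZMod ℓ')ˣ →* Multiplicative (ZMod (3 ^ 1)))
    (hψ : Function.Surjective (ψ ℓ)) (hδ : kuriharaNumber D.f (3 ^ 1) ℓ ψ ≠ 0) :
    X4.MissingInputAt W 3 ↔ padicValRat 3 q = 0 := by
  have hr1 : W.analyticRank ≤ 1 := by rw [hr]
  have hL : W.entireLFunction 1 = 0 := by
    by_contra hne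
    have h0 := (W.analyticRank_eq_zero_iff_holds (hmod W)).mpr hne
    omega
  obtain ⟨-, hfin⟩ := hGZK W hr1
  haveI : Finite W.sha := hfin
  have hiff := bsdp_iff_padicValRat_eq_zero_of_kimRankOneUnitAt W 3
    (kimRankOneUnitAt_three_of_classX4 W h3 hX) hGZK hsurj htower hL hr D (by exact_mod_cast hc)
    hper ℓ hℓ hcyc ψ hψ hδ hq
  constructor
  · intro hm
    exact hiff.mp (bsdp_of_missingPPartAt W 3 hGZK hr1 hm)
  · intro hv0
    exact missingPPartAt_of_bsdp W 3 (hiff.mpr hv0)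

end Summit.BirchSwinnertonDyer.Rank1Residual.Additive

end
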